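/-
Width seat `ym-line-cbag-p1-w3` (prover-ym-line-cbag-p1-w3-g10-0; own items stmt-QuantumFields-22254 / 22893 CLOSED): by-name closure of the
four `@[conjecture]` floor nodes of `Theorems/SoloInformedNonFreezingFloor.lean` and `Theorems/SoloInformedLogFloor.lean` from LINE 3
(`route-QuantumFields-SixPlaneColdBox`, all items proved).  RECORD-type material; the Yang–Mills mass gap is NOT proved by anything here.
-/
import Summits.QuantumFields.YangMills.Theorems.SixPlaneColdBoxBulkDominatesBoxDensityG
import Summits.QuantumFields.YangMills.Theorems.SoloInformedLogFloor

/-!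
# The solo seat's floor nodes hold: `PolynomialFloorWitness`, `SmearedFloorWitness`, `LogFloorWitness`, `SmearedLogFloorWitness`

The solo seat `solo-QuantumFields-informed` typed a ladder of closed propositions under the node `Theorems.LatticeNonFreezing`
(Chatterjee, arXiv:1803.01950, Problem 5.1(b), volume-uniform form), each marked `@[conjecture]`:

* `PolynomialFloorWitness` (`SoloInformedNonFreezingFloor`): a floor `c β^{-p}` on ONE plaquette-pair truncated correlation of the species
  `r.curvature.F` at polynomial separation `β ≤ n^k`, for all large `β`, on every large odd torus;
* `SmearedFloorWitness` (ibid.): the same for a finite weighted sum of pair correlations (`c β^{-p} ∑|W| < |∑ W · corr|`);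
* `LogFloorWitness`, `SmearedLogFloorWitness` (`SoloInformedLogFloor`): the same two at poly-logarithmic separation `(log β)² ≤ a·n`.

LINE 3 of the ideator cell ym-idea-2 (route `SixPlaneColdBox`) proved its target `BulkDominatesBoxDensityG`
(`SixPlaneColdBox.bulkDominatesBoxDensityG_proof`), and the route's assembly file already contains
`SixPlaneColdBox.polynomialFloorWitness_of_bulkDominatesBoxDensityG : BulkDominatesBoxDensityG → PolynomialFloorWitness`.
This file records the four nodes as THEOREMS, by name:

* `polynomialFloorWitness_holds` — the composition just named;
* `smearedFloorWitness_of_polynomialFloor` / `smearedFloorWitness_holds` — a single pair is a one-term smearing (weight `1`, constant `c/2`,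
  threshold raised to `β ≥ 1` so that `β^p > 0`); converse of the tree's pigeonhole `polynomialFloorWitness_of_smeared`;
* `logFloorWitness_holds` — via the tree's `logFloorWitness_of_polynomialFloor`;
* `smearedLogFloorWitness_of_logFloor` / `smearedLogFloorWitness_holds` — the one-term smearing again.

What stays OPEN (deliberately not touched here): `TreeLevelLimitWitness` (`SoloInformedTreeLevel`: a TWO-SIDED smeared asymptotic
`β²·∑W·corr → q` with a power rate — needs the two-sided averaging step over boundary data, not in the tree), `RPVariationalWitness`
(`SoloInformedNonFreezing`: the one-step variational estimate `(1-δ) f(0) ≤ f(1)`, same two-sided input), and everything downstream of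
exponential clustering.  No sorry; standard axioms.  NOT the Yang–Mills mass gap; no summit statement and no rung is proved by this file.
-/

set_option autoImplicit false

noncomputable section

open MeasureTheory Filter Topology
open Literature.MathematicalPhysics.QuantumFieldTheory
open Literature.MathematicalPhysics.QuantumLattice
open Literature.Probability.LatticeModels

namespace Summit.QuantumFields.YangMills.Theorems

/-! ### Polynomial separation -/

/-- **`PolynomialFloorWitness` holds** (node of `SoloInformedNonFreezingFloor`): for every compact simple `G` and faithful unitary lattice
representation `r` there are `k p : ℕ`, `c > 0` such that for all large `β`, on every large odd torus `2S+1`, some time-translate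
`n ≤ S` with `β ≤ n^k` (and spatial offset `y`, `y 0 = 0`) of the action density `r.curvature.F` has truncated two-point function
`≥ c β^{-p}` in modulus.  Proof: LINE 3's target `SixPlaneColdBox.bulkDominatesBoxDensityG_proof` fed to the assembly lemma
`SixPlaneColdBox.polynomialFloorWitness_of_bulkDominatesBoxDensityG`.  NOT the Yang–Mills mass gap. -/
theorem polynomialFloorWitness_holds : PolynomialFloorWitness :=
  SixPlaneColdBox.polynomialFloorWitness_of_bulkDominatesBoxDensityG SixPlaneColdBox.bulkDominatesBoxDensityG_proof

/-- **One pair is a one-term smearing**: `PolynomialFloorWitness → SmearedFloorWitness` with the same `k, p`, constant `c/2`, the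
displacement set `{(n, y)}` and weight `W = 1` (threshold `max β₁ 1`, so that `β^p > 0` and `c/(2β^p) < c/β^p ≤ |corr|`).  Converse of the
tree's pigeonhole `polynomialFloorWitness_of_smeared`. -/
theorem smearedFloorWitness_of_polynomialFloor (hW : PolynomialFloorWitness) : SmearedFloorWitness := by
  intro G _ _ _ _ hG
  letI : MeasurableSpace G := borel G
  haveI : BorelSpace G := ⟨rfl⟩
  intro r
  obtain ⟨k, p, c, hc, β₁, hβ₁⟩ := hW G hG r
  refine ⟨k, p, c / 2, by positivity, max β₁ 1, fun β hβ => ?_⟩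
  have hβ₁' : β₁ ≤ β := le_trans (le_max_left _ _) hβ
  have hβpos : 0 < β := lt_of_lt_of_le one_pos (le_trans (le_max_right _ _) hβ)
  obtain ⟨S₁, hS₁⟩ := hβ₁ β hβ₁'
  refine ⟨S₁, fun S hS => ?_⟩
  obtain ⟨n, y, hsep, hnS, hy, hfloor⟩ := hS₁ S hS
  refine ⟨{(n, y)}, fun _ => 1, fun d hd => ?_, ?_⟩
  · rw [Finset.mem_singleton] at hd
    subst hd
    exact ⟨hsep, hnS, hy⟩
  · have hβp : 0 < β ^ p := pow_pos hβpos p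
    rw [Finset.sum_singleton, Finset.sum_singleton, abs_one, mul_one, one_mul]
    have h1 : c * (β ^ p)⁻¹ ≤ |latticeConnectedCorr r.ρ β (2 * S + 1) r.curvature.F
        (fun U => r.curvature.F (configShift (-y) U)) n| := by
      rw [← div_eq_mul_inv, div_le_iff₀ hβp, mul_comm]
      exact hfloor
    have h2 : c / 2 * (β ^ p)⁻¹ < c * (β ^ p)⁻¹ :=
      mul_lt_mul_of_pos_right (by linarith) (inv_pos.mpr hβp)
    exact lt_of_lt_of_le h2 h1

/-- **`SmearedFloorWitness` holds** (node of `SoloInformedNonFreezingFloor`, the "assembled form" of the floor): from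
`polynomialFloorWitness_holds` by the one-term smearing `smearedFloorWitness_of_polynomialFloor`.  NOT the Yang–Mills mass gap. -/
theorem smearedFloorWitness_holds : SmearedFloorWitness :=
  smearedFloorWitness_of_polynomialFloor polynomialFloorWitness_holds

/-! ### Poly-logarithmic separation -/

/-- **`LogFloorWitness` holds** (node of `SoloInformedLogFloor`: a floor `c β^{-p}` on one pair correlation of the action density at
separation `(log β)² ≤ a·n`, all large `β`, all large odd tori): the tree's `logFloorWitness_of_polynomialFloor` applied to
`polynomialFloorWitness_holds`.  NOT the Yang–Mills mass gap. -/
theorem logFloorWitness_holds : LogFloorWitness :=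
  logFloorWitness_of_polynomialFloor polynomialFloorWitness_holds

/-- **One pair is a one-term smearing, poly-logarithmic separation**: `LogFloorWitness → SmearedLogFloorWitness` (same `p, a`, constant
`c/2`, displacement set `{(n, y)}`, weight `1`, threshold `max β₁ 1`).  Converse of the tree's pigeonhole `logFloorWitness_of_smearedLog`. -/
theorem smearedLogFloorWitness_of_logFloor (hW : LogFloorWitness) : SmearedLogFloorWitness := by
  intro G _ _ _ _ hG
  letI : MeasurableSpace G := borel G
  haveI : BorelSpace G := ⟨rfl⟩
  intro r
  obtain ⟨p, a, c, ha, hc, β₁, hβ₁⟩ := hW G hG r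
  refine ⟨p, a, c / 2, ha, by positivity, max β₁ 1, fun β hβ => ?_⟩
  have hβ₁' : β₁ ≤ β := le_trans (le_max_left _ _) hβ
  have hβpos : 0 < β := lt_of_lt_of_le one_pos (le_trans (le_max_right _ _) hβ)
  obtain ⟨S₁, hS₁⟩ := hβ₁ β hβ₁'
  refine ⟨S₁, fun S hS => ?_⟩
  obtain ⟨n, y, hsep, hnS, hy, hfloor⟩ := hS₁ S hS
  refine ⟨{(n, y)}, fun _ => 1, fun d hd => ?_, ?_⟩
  · rw [Finset.mem_singleton] at hd
    subst hd
    exact ⟨hsep, hnS, hy⟩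
  · have hβp : 0 < β ^ p := pow_pos hβpos p
    rw [Finset.sum_singleton, Finset.sum_singleton, abs_one, mul_one, one_mul]
    have h1 : c * (β ^ p)⁻¹ ≤ |latticeConnectedCorr r.ρ β (2 * S + 1) r.curvature.F
        (fun U => r.curvature.F (configShift (-y) U)) n| := by
      rw [← div_eq_mul_inv, div_le_iff₀ hβp, mul_comm]
      exact hfloor
    have h2 : c / 2 * (β ^ p)⁻¹ < c * (β ^ p)⁻¹ :=
      mul_lt_mul_of_pos_right (by linarith) (inv_pos.mpr hβp)
    exact lt_of_lt_of_le h2 h1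

/-- **`SmearedLogFloorWitness` holds** (node of `SoloInformedLogFloor`, assembled form at poly-logarithmic separation): from
`logFloorWitness_holds` by `smearedLogFloorWitness_of_logFloor`.  NOT the Yang–Mills mass gap. -/
theorem smearedLogFloorWitness_holds : SmearedLogFloorWitness :=
  smearedLogFloorWitness_of_logFloor logFloorWitness_holds

end Summit.QuantumFields.YangMills.Theorems

end
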